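import Summits.QuantumFields.YangMills.Theorems.EquipartitionCriticalityEquipartitionPinsProbeTangentPlaqFieldContinuous
import Summits.QuantumFields.YangMills.Theorems.EquipartitionCriticalityEquipartitionPinsProbeTangentSteinPrelim
import Summits.QuantumFields.YangMills.Theorems.SteinGapBootstrapFreeProbeLawGResum
import HarnessLib

/-!
# Crux U `FreeProbeLawG` (stmt-QuantumFields-23756), line `birth` — assembly part A3a: the Green-resummed Schwinger–Dyson identity

Lead `ym-line-sgb-k1-g1`; helper toward the registered stub `stub_assembly`. For a torus-limit state `μ`, a finite plaquette set `S`,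
a `1`-form `ω` supported on a finite edge set `E` with `plaquettesTouching {e} ⊆ S` for `e ∈ E`, and the single-edge Schwinger–Dyson
identities of `μ` on `S` with error `εsd·(1+M)` (the registered stub `stub_sdRate`, specialised), every bounded `C¹` test function `g`
of the block field `Y_S` (`|g| ≤ A₀`, `‖Dg‖ ≤ A₁`) satisfies the RESUMMED identity
`|E_μ[Dg(Y_S)[vec_ω]] − E_μ[g(Y_S)·⟨dω, Y^a⟩_S]| ≤ ‖ω‖₁ · εsd · (A₀ + A₁)`, `vec_ω = (q,b) ↦ [b = a](dω)(q)`
(`resummed_sd`): multiply the identity at `e` by `ω(e)` and sum, using `(dω)(q) = Σ_e ω(e)(dδ_e)(q)` (`Resum.plaquetteCurl_resum`).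
HONEST LABEL: RECORD rung R2ξ-G only; nothing here bears on the Yang–Mills mass gap.
References: S. Chatterjee, arXiv:1602.01222, §11 [arXiv160201222]; E. Meckes, IMS Coll. 5 (2009), Lemma 1 [Meckes2009].
-/

set_option autoImplicit false

noncomputable section

open MeasureTheory Finset
open Literature.Probability.LatticeModels Literature.MathematicalPhysics.QuantumLattice
open Literature.MathematicalPhysics.QuantumFieldTheory hiding ZdEdge IsLocalObservable IsInfiniteVolumeLimit
open Summit.QuantumFields.YangMills.Theorems.EquipartitionPinsProbe

namespace Summit.QuantumFields.YangMills.Cruxes.FreeProbeLawG.SteinFree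

namespace AssemblyCore

variable {G : Type} [Group G] [TopologicalSpace G] [IsTopologicalGroup G]

/-- Continuity of the block field `U ↦ (Y_S U : S → Fin D → ℝ)`. -/
theorem continuous_blockField (r : LatticeRep G) (β : ℝ) (S : Finset (ZdPlaquette 4)) :
    Continuous fun U : LGConfig 4 G => (fun (q : ↥S) (b : Fin (lieDim r)) => plaqField r β U (q : ZdPlaquette 4) b) := by
  refine continuous_pi fun q => continuous_pi fun b => ?_
  exact TangentPlaqFieldContinuous.continuous_plaqField_apply r β (q : ZdPlaquette 4) b

variable [CompactSpace G] [MeasurableSpace G] [BorelSpace G]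

omit [Group G] [IsTopologicalGroup G] in
/-- A bounded continuous real function on the (compact) configuration space is integrable for a finite measure. -/
theorem integrable_of_continuous_bdd (μ : Measure (LGConfig 4 G)) [IsFiniteMeasure μ] [SecondCountableTopology G]
    {f : LGConfig 4 G → ℝ} (hf : Continuous f) : Integrable f μ := by
  obtain ⟨C, -, hC⟩ := TangentSteinFiniteBeta.exists_abs_le_of_continuous hf
  exact Integrable.of_bound hf.aestronglyMeasurable C (ae_of_all _ fun U => by rw [Real.norm_eq_abs]; exact hC U)

/-- **The Green-resummed Schwinger–Dyson identity.** See the module docstring. -/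
theorem resummed_sd [SecondCountableTopology G] (r : LatticeRep G) (β : ℝ) (μ : Measure (LGConfig 4 G)) [IsFiniteMeasure μ]
    (S : Finset (ZdPlaquette 4)) (E : Finset (ZdEdge 4)) (ω : ZdEdge 4 → ℝ) (hωE : ∀ e, ω e ≠ 0 → e ∈ E)
    (a : Fin (lieDim r)) {εsd : ℝ}
    (hSD : ∀ e ∈ E, ∀ (g : (↥S → Fin (lieDim r) → ℝ) → ℝ) (M : ℝ), 0 ≤ M → ContDiff ℝ 1 g →
      (∀ y, |g y| ≤ 1) → (∀ y, ‖fderiv ℝ g y‖ ≤ M) →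
      |(∑ p' : ↥S, plaquetteCurl (fun e' => if e' = e then (1 : ℝ) else 0) (p' : ZdPlaquette 4) *
            ∫ U, fderiv ℝ g (fun q b => plaqField r β U (q : ZdPlaquette 4) b)
              (fun q b => if q = p' ∧ b = a then (1 : ℝ) else 0) ∂μ) -
          ∫ U, g (fun q b => plaqField r β U (q : ZdPlaquette 4) b) *
            (∑ p' ∈ S, plaquetteCurl (fun e' => if e' = e then (1 : ℝ) else 0) p' * plaqField r β U p' a) ∂μ| ≤
        εsd * (1 + M))
    (g : (↥S → Fin (lieDim r) → ℝ) → ℝ) {A₀ A₁ : ℝ} (hA₀ : 0 < A₀) (hA₁ : 0 ≤ A₁) (hg : ContDiff ℝ 1 g)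
    (hg0 : ∀ y, |g y| ≤ A₀) (hg1 : ∀ y, ‖fderiv ℝ g y‖ ≤ A₁) :
    |(∫ U, fderiv ℝ g (fun q b => plaqField r β U (q : ZdPlaquette 4) b)
          (fun q b => if b = a then plaquetteCurl ω (q : ZdPlaquette 4) else 0) ∂μ) -
        ∫ U, g (fun q b => plaqField r β U (q : ZdPlaquette 4) b) *
          (∑ p' ∈ S, plaquetteCurl ω p' * plaqField r β U p' a) ∂μ| ≤
      (∑ e ∈ E, |ω e|) * (εsd * (A₀ + A₁)) := by
  classical
  have hYc : Continuous fun U : LGConfig 4 G => (fun (q : ↥S) (b : Fin (lieDim r)) => plaqField r β U (q : ZdPlaquette 4) b) :=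
    continuous_blockField r β S
  -- the SD identity for `g` itself (rescale `g/A₀`)
  have hSDg : ∀ e ∈ E,
      |(∑ p' : ↥S, plaquetteCurl (fun e' => if e' = e then (1 : ℝ) else 0) (p' : ZdPlaquette 4) * ∫ U, fderiv ℝ g (fun (q : ↥S) (b : Fin (lieDim r)) => plaqField r β U (q : ZdPlaquette 4) b) (fun q b => if q = p' ∧ b = a then (1 : ℝ) else 0) ∂μ) -
          ∫ U, g (fun (q : ↥S) (b : Fin (lieDim r)) => plaqField r β U (q : ZdPlaquette 4) b) * (∑ p' ∈ S, plaquetteCurl (fun e' => if e' = e then (1 : ℝ) else 0) p' * plaqField r β U p' a) ∂μ| ≤ εsd * (A₀ + A₁) := by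
    intro e he
    have hg' : ContDiff ℝ 1 (fun y => A₀⁻¹ * g y) := contDiff_const.mul hg
    have hg'0 : ∀ y, |A₀⁻¹ * g y| ≤ 1 := fun y => by
      rw [abs_mul, abs_of_pos (inv_pos.2 hA₀)]
      calc A₀⁻¹ * |g y| ≤ A₀⁻¹ * A₀ := mul_le_mul_of_nonneg_left (hg0 y) (inv_pos.2 hA₀).le
        _ = 1 := inv_mul_cancel₀ hA₀.ne'
    have hfd : ∀ y, fderiv ℝ (fun y => A₀⁻¹ * g y) y = A₀⁻¹ • fderiv ℝ g y := fun y => by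
      have : (fun y => A₀⁻¹ * g y) = A₀⁻¹ • g := by funext y; simp [smul_eq_mul]
      rw [this, fderiv_const_smul (hg.differentiable one_ne_zero y)]
    have hg'1 : ∀ y, ‖fderiv ℝ (fun y => A₀⁻¹ * g y) y‖ ≤ A₁ / A₀ := fun y => by
      rw [hfd y, norm_smul, Real.norm_eq_abs, abs_of_pos (inv_pos.2 hA₀), div_eq_inv_mul]
      exact mul_le_mul_of_nonneg_left (hg1 y) (inv_pos.2 hA₀).le
    have h := hSD e he (fun y => A₀⁻¹ * g y) (A₁ / A₀) (div_nonneg hA₁ hA₀.le) hg' hg'0 hg'1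
    -- unscale
    have e1 : ∀ p' : ↥S, ∫ U, fderiv ℝ (fun y => A₀⁻¹ * g y) (fun (q : ↥S) (b : Fin (lieDim r)) => plaqField r β U (q : ZdPlaquette 4) b) (fun q b => if q = p' ∧ b = a then (1 : ℝ) else 0) ∂μ =
        A₀⁻¹ * ∫ U, fderiv ℝ g (fun (q : ↥S) (b : Fin (lieDim r)) => plaqField r β U (q : ZdPlaquette 4) b) (fun q b => if q = p' ∧ b = a then (1 : ℝ) else 0) ∂μ := fun p' => by
      rw [← integral_const_mul]
      refine integral_congr_ae (ae_of_all _ fun U => ?_)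
      dsimp only
      rw [hfd]
      rfl
    have e2 : ∫ U, A₀⁻¹ * g (fun (q : ↥S) (b : Fin (lieDim r)) => plaqField r β U (q : ZdPlaquette 4) b) * (∑ p' ∈ S, plaquetteCurl (fun e' => if e' = e then (1 : ℝ) else 0) p' * plaqField r β U p' a) ∂μ =
        A₀⁻¹ * ∫ U, g (fun (q : ↥S) (b : Fin (lieDim r)) => plaqField r β U (q : ZdPlaquette 4) b) * (∑ p' ∈ S, plaquetteCurl (fun e' => if e' = e then (1 : ℝ) else 0) p' * plaqField r β U p' a) ∂μ := by
      rw [← integral_const_mul]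
      refine integral_congr_ae (ae_of_all _ fun U => ?_)
      ring
    simp only [e1] at h
    rw [e2] at h
    have hfac : (∑ p' : ↥S, plaquetteCurl (fun e' => if e' = e then (1 : ℝ) else 0) (p' : ZdPlaquette 4) * (A₀⁻¹ * ∫ U, fderiv ℝ g (fun (q : ↥S) (b : Fin (lieDim r)) => plaqField r β U (q : ZdPlaquette 4) b) (fun q b => if q = p' ∧ b = a then (1 : ℝ) else 0) ∂μ)) -
        A₀⁻¹ * ∫ U, g (fun (q : ↥S) (b : Fin (lieDim r)) => plaqField r β U (q : ZdPlaquette 4) b) * (∑ p' ∈ S, plaquetteCurl (fun e' => if e' = e then (1 : ℝ) else 0) p' * plaqField r β U p' a) ∂μ =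
        A₀⁻¹ * ((∑ p' : ↥S, plaquetteCurl (fun e' => if e' = e then (1 : ℝ) else 0) (p' : ZdPlaquette 4) * ∫ U, fderiv ℝ g (fun (q : ↥S) (b : Fin (lieDim r)) => plaqField r β U (q : ZdPlaquette 4) b) (fun q b => if q = p' ∧ b = a then (1 : ℝ) else 0) ∂μ) -
          ∫ U, g (fun (q : ↥S) (b : Fin (lieDim r)) => plaqField r β U (q : ZdPlaquette 4) b) * (∑ p' ∈ S, plaquetteCurl (fun e' => if e' = e then (1 : ℝ) else 0) p' * plaqField r β U p' a) ∂μ) := by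
      rw [mul_sub, Finset.mul_sum]
      congr 1
      exact Finset.sum_congr rfl fun p' _ => by ring
    rw [hfac, abs_mul, abs_of_pos (inv_pos.2 hA₀)] at h
    have := mul_le_mul_of_nonneg_left h hA₀.le
    rw [← mul_assoc, mul_inv_cancel₀ hA₀.ne', one_mul] at this
    refine this.trans (le_of_eq ?_)
    field_simp
  -- integrability of the players
  have hgc : Continuous g := hg.continuous
  have hfdc : Continuous (fderiv ℝ g) := hg.continuous_fderiv one_ne_zero
  have iI : ∀ v : ↥S → Fin (lieDim r) → ℝ, Integrable (fun U => fderiv ℝ g (fun (q : ↥S) (b : Fin (lieDim r)) => plaqField r β U (q : ZdPlaquette 4) b) v) μ := fun v =>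
    integrable_of_continuous_bdd μ ((hfdc.comp hYc).clm_apply continuous_const)
  have hYqc : ∀ (q : ZdPlaquette 4), Continuous fun U : LGConfig 4 G => plaqField r β U q a := fun q =>
    TangentPlaqFieldContinuous.continuous_plaqField_apply r β q a
  have iJ : ∀ e, Integrable (fun U => g (fun (q : ↥S) (b : Fin (lieDim r)) => plaqField r β U (q : ZdPlaquette 4) b) * (∑ p' ∈ S, plaquetteCurl (fun e' => if e' = e then (1 : ℝ) else 0) p' * plaqField r β U p' a)) μ :=
    fun e => integrable_of_continuous_bdd μ ((hgc.comp hYc).mul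
      (continuous_finsetSum _ fun p' _ => continuous_const.mul (hYqc p')))
  have iJω : Integrable (fun U => g (fun (q : ↥S) (b : Fin (lieDim r)) => plaqField r β U (q : ZdPlaquette 4) b) * (∑ p' ∈ S, plaquetteCurl ω p' * plaqField r β U p' a)) μ :=
    integrable_of_continuous_bdd μ ((hgc.comp hYc).mul (continuous_finsetSum _ fun p' _ => continuous_const.mul (hYqc p')))
  -- resummation of the derivative side
  have hder : ∑ e ∈ E, ω e * (∑ p' : ↥S, plaquetteCurl (fun e' => if e' = e then (1 : ℝ) else 0) (p' : ZdPlaquette 4) * ∫ U, fderiv ℝ g (fun (q : ↥S) (b : Fin (lieDim r)) => plaqField r β U (q : ZdPlaquette 4) b) (fun q b => if q = p' ∧ b = a then (1 : ℝ) else 0) ∂μ) =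
      ∫ U, fderiv ℝ g (fun (q : ↥S) (b : Fin (lieDim r)) => plaqField r β U (q : ZdPlaquette 4) b) (fun q b => if b = a then plaquetteCurl ω (q : ZdPlaquette 4) else 0) ∂μ := by
    -- swap the sums and resum the curl
    have h1 : ∑ e ∈ E, ω e * (∑ p' : ↥S, plaquetteCurl (fun e' => if e' = e then (1 : ℝ) else 0) (p' : ZdPlaquette 4) * ∫ U, fderiv ℝ g (fun (q : ↥S) (b : Fin (lieDim r)) => plaqField r β U (q : ZdPlaquette 4) b) (fun q b => if q = p' ∧ b = a then (1 : ℝ) else 0) ∂μ) =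
        ∑ p' : ↥S, plaquetteCurl ω (p' : ZdPlaquette 4) * ∫ U, fderiv ℝ g (fun (q : ↥S) (b : Fin (lieDim r)) => plaqField r β U (q : ZdPlaquette 4) b) (fun q b => if q = p' ∧ b = a then (1 : ℝ) else 0) ∂μ := by
      simp_rw [Finset.mul_sum]
      rw [Finset.sum_comm]
      refine Finset.sum_congr rfl fun p' _ => ?_
      rw [Resum.plaquetteCurl_resum hωE (p' : ZdPlaquette 4), Finset.sum_mul]
      exact Finset.sum_congr rfl fun e _ => by ring
    rw [h1]
    -- linearity of the integral and of `fderiv g (fun (q : ↥S) (b : Fin (lieDim r)) => plaqField r β U (q : ZdPlaquette 4) b)`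
    have h2 : ∑ p' : ↥S, plaquetteCurl ω (p' : ZdPlaquette 4) * ∫ U, fderiv ℝ g (fun (q : ↥S) (b : Fin (lieDim r)) => plaqField r β U (q : ZdPlaquette 4) b) (fun q b => if q = p' ∧ b = a then (1 : ℝ) else 0) ∂μ =
        ∫ U, ∑ p' : ↥S, plaquetteCurl ω (p' : ZdPlaquette 4) * fderiv ℝ g (fun (q : ↥S) (b : Fin (lieDim r)) => plaqField r β U (q : ZdPlaquette 4) b) (fun q b => if q = p' ∧ b = a then (1 : ℝ) else 0) ∂μ := by
      rw [integral_finsetSum _ fun p' _ => (iI (fun q b => if q = p' ∧ b = a then (1 : ℝ) else 0)).const_mul _]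
      exact Finset.sum_congr rfl fun p' _ => (integral_const_mul _ _).symm
    rw [h2]
    refine integral_congr_ae (ae_of_all _ fun U => ?_)
    have h3 : (fun (q : ↥S) (b : Fin (lieDim r)) => if b = a then plaquetteCurl ω (q : ZdPlaquette 4) else 0) =
        ∑ p' : ↥S, plaquetteCurl ω (p' : ZdPlaquette 4) • (fun (q : ↥S) (b : Fin (lieDim r)) => if q = p' ∧ b = a then (1 : ℝ) else 0) := by
      rw [Resum.sum_smul_basis_eq]
    simp only [h3, map_sum, map_smul, smul_eq_mul]
  -- resummation of the field side
  have hfld : ∑ e ∈ E, ω e * ∫ U, g (fun (q : ↥S) (b : Fin (lieDim r)) => plaqField r β U (q : ZdPlaquette 4) b) * (∑ p' ∈ S, plaquetteCurl (fun e' => if e' = e then (1 : ℝ) else 0) p' * plaqField r β U p' a) ∂μ =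
      ∫ U, g (fun (q : ↥S) (b : Fin (lieDim r)) => plaqField r β U (q : ZdPlaquette 4) b) * (∑ p' ∈ S, plaquetteCurl ω p' * plaqField r β U p' a) ∂μ := by
    have h1 : ∑ e ∈ E, ω e * ∫ U, g (fun (q : ↥S) (b : Fin (lieDim r)) => plaqField r β U (q : ZdPlaquette 4) b) * (∑ p' ∈ S, plaquetteCurl (fun e' => if e' = e then (1 : ℝ) else 0) p' * plaqField r β U p' a) ∂μ =
        ∫ U, ∑ e ∈ E, ω e * (g (fun (q : ↥S) (b : Fin (lieDim r)) => plaqField r β U (q : ZdPlaquette 4) b) * (∑ p' ∈ S, plaquetteCurl (fun e' => if e' = e then (1 : ℝ) else 0) p' * plaqField r β U p' a)) ∂μ := by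
      rw [integral_finsetSum _ fun e _ => (iJ e).const_mul _]
      exact Finset.sum_congr rfl fun e _ => (integral_const_mul _ _).symm
    rw [h1]
    refine integral_congr_ae (ae_of_all _ fun U => ?_)
    have h4 : ∀ p' : ZdPlaquette 4, plaquetteCurl ω p' = ∑ e ∈ E, ω e * plaquetteCurl (fun e' => if e' = e then (1 : ℝ) else 0) p' := fun p' =>
      Resum.plaquetteCurl_resum hωE p'
    simp only [h4, Finset.sum_mul, Finset.mul_sum]
    rw [Finset.sum_comm]
    refine Finset.sum_congr rfl fun e _ => Finset.sum_congr rfl fun p' _ => ?_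
    ring
  -- combine
  rw [← hder, ← hfld, ← Finset.sum_sub_distrib]
  calc |∑ e ∈ E, (ω e * (∑ p' : ↥S, plaquetteCurl (fun e' => if e' = e then (1 : ℝ) else 0) (p' : ZdPlaquette 4) * ∫ U, fderiv ℝ g (fun (q : ↥S) (b : Fin (lieDim r)) => plaqField r β U (q : ZdPlaquette 4) b) (fun q b => if q = p' ∧ b = a then (1 : ℝ) else 0) ∂μ) -
          ω e * ∫ U, g (fun (q : ↥S) (b : Fin (lieDim r)) => plaqField r β U (q : ZdPlaquette 4) b) * (∑ p' ∈ S, plaquetteCurl (fun e' => if e' = e then (1 : ℝ) else 0) p' * plaqField r β U p' a) ∂μ)|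
      ≤ ∑ e ∈ E, |ω e * (∑ p' : ↥S, plaquetteCurl (fun e' => if e' = e then (1 : ℝ) else 0) (p' : ZdPlaquette 4) * ∫ U, fderiv ℝ g (fun (q : ↥S) (b : Fin (lieDim r)) => plaqField r β U (q : ZdPlaquette 4) b) (fun q b => if q = p' ∧ b = a then (1 : ℝ) else 0) ∂μ) -
          ω e * ∫ U, g (fun (q : ↥S) (b : Fin (lieDim r)) => plaqField r β U (q : ZdPlaquette 4) b) * (∑ p' ∈ S, plaquetteCurl (fun e' => if e' = e then (1 : ℝ) else 0) p' * plaqField r β U p' a) ∂μ| :=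
        Finset.abs_sum_le_sum_abs _ _
    _ ≤ ∑ e ∈ E, |ω e| * (εsd * (A₀ + A₁)) := by
        refine Finset.sum_le_sum fun e he => ?_
        rw [← mul_sub, abs_mul]
        exact mul_le_mul_of_nonneg_left (hSDg e he) (abs_nonneg _)
    _ = (∑ e ∈ E, |ω e|) * (εsd * (A₀ + A₁)) := by rw [Finset.sum_mul]

end AssemblyCore

end Summit.QuantumFields.YangMills.Cruxes.FreeProbeLawG.SteinFree

end
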